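import Summits.ABC.ABC.Theses.DefiniteXi
import Summits.ABC.ABC.Theorems.EisensteinQuarantine.Negative.EisensteinQuarantineFalseOfProthDepthFamily
import Summits.ABC.ABC.Theorems.XiBound.Negative.XiBoundDomainSetup
import Summits.ABC.ABC.Theorems.DefiniteXiEisensteinQuarantineThreeAdicCalibration
import Literature.NumberTheory.EllipticCurves.SerreFreyValuationProductProofs
import Literature.NumberTheory.LFunctions.DedekindZeta
import HarnessLib

/-!
# Line `eta2-residuacity-depth` — REFUTING skeleton for the crux `DefiniteXi.EisensteinQuarantine`
(stmt-ABC-15023, route `route-ABC-DefiniteXi`, rank 5) — crux-plan seat, 2026-08-16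

Idea card: `Cruxes/EisensteinQuarantine/Ideas/eta2-residuacity-depth.md` (round-2 ideator 5; triage r2: 2/2 pass).
Line card: `Cruxes/EisensteinQuarantine/Lines/eta2-residuacity-depth.md`.

**What this line decides.** The crux AS FILED (`sixPart ξ(E; N/N⁻, N⁻) ≤ C_ε N^ε · 𝓛`) is census-false on the
Legendre–Proth family `F = {E_(−p,p−1) : p = k·2^s + 1 prime, N⁻ := p}` (direct Brandt census kit j017527, degree
censuses j016666/j017919/…, `Lines/Sketch-dead.md`, `Disproof.lean` §2) and a kernel-checked CONDITIONAL kill is in the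
tree: `EisensteinQuarantine_false_of_ProthDepthFamily : ProthDepthFamily → ¬ EisensteinQuarantine` (p107816).  Its
hypothesis `H = ProthDepthFamily` was motivated by a UNIFORM depth law in `s = v₂(p−1)` which is itself census-false
(Pierpont row `p = 786433`, `s = 18`, depth 8).  This line re-grounds `H` correctly and reduces it to three genuine
theorems-to-be, so that `¬ EisensteinQuarantine` follows from the Extended Riemann Hypothesis alone:

* the 2-adic depth of `ξ(N/p, p)` is governed NOT by `s` but by the **2-power residuacity depth of 2 modulo the
  quarantined prime**, `m₂(p) := v₂[𝔽_p^× : ⟨2⟩] = v₂((p−1)/ord_p 2)` (`twoDepth p` below) — Mazur's `η₂ = T₂ − 3` acts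
  on the higher Eisenstein elements of the level-`p` cluster through `log √2 ∈ (ℤ/p)^× ⊗ ℤ₂`, of valuation `m₂(p) − 1`
  (Calegari–Emerton, arXiv:math/0311368 Prop. 3.17(ii); Lecouturier, arXiv:1709.09114 §1, Thm. 1.5, §3.6), and the Frey
  line (`U₂ = +1`, split multiplicative at `2 ∥ N`) meets the ordinary old line to the full depth of `η₂`.  Census:
  `d := v₂ ξ(N/p,p) ≥ m₂(p) + 3` on 36/36 levels, equality at the Fermat primes 257 (`ξ(2,257) = 2⁷`, `m₂ = 4`) and
  65537 (`m₂ = 11`, `d = 14`); both triagers re-derived the table.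
* the prime SUPPLY the refutation needs is "arbitrarily deep 2-residuacity at polynomial height": primes `p ≤ 2^{As}`
  splitting completely in `K_s = ℚ(ζ_{2^s}, 2^{1/2^s})` — TRUE under ERH by Lagarias–Odlyzko (the GRH prime-ideal
  bounds are PROVED in the tree, uniformly in the field: `Literature.NumberTheory.LFunctions.NumberField.
  primeIdealCount_ge_of_erh`, `exists_abs_chebyshevPsiIdeal_sub_self_le_of_erh`), unconditionally an open
  least-prime-in-Chebotarev problem (triage r2-1/r2-2).

**Registered stubs** (sorried; each a genuine theorem of the line, none restates the crux, `H`, or a refuted statement):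
* `stub_freyEigenLineRankOne` — Jacquet–Langlands/Eichler + strong multiplicity one on the crux's whole domain: in every Brandt
  setup of type `(N/N⁻, N⁻)` the `a(E)`-eigen-lattice of the Brandt matrices is a LINE `ℤ φ`, `φ ≠ 0` (TRUE in print;
  L/XL formal debt; it is also the tacit "rank one" premise every LOWER bound on `ξ` needs — triage r2-1 sharpen (2)).
  SHARED VERBATIM (same name, same signature) with the sibling line `Lines/forced_pair_dlog.lean` (crux-plan seat
  forced-pair-dlog, written two minutes earlier and found after this file first registered): one proof serves both lines.
* `stub_etaTwoWitness` — THE MECHANISM (hardest, XL, research-level at `ℓ = 2`): on `F`, for every setup of type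
  `(N/p, p)` and every generator `φ` of the Frey line there is a Brandt vector `ψ ⊥_w φ` with `φ ≡ ψ (mod 2^{m₂(p) − c})`
  (`c` absolute).  This is the η₂-depth law in the certificate format of the landed dictionary (p96490).
* `stub_deepTwoSupply_of_erh` — ERH (`Literature.NumberTheory.LFunctions.ExtendedRiemannHypothesis`, the tree's
  `@[conjecture]`) ⟹ `DeepTwoProthSupply` (TRUE in print: Lagarias–Odlyzko 1977 / Bach–Sorenson 1996; L).

**Sorry-free glue (this file):** `etaTwoDepthLaw_of_witness` (stubs 1–2 ⟹ `EtaTwoDepthLaw`, via the LANDED occurrence lemma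
`Summit.ABC.ABC.Theorems.pow_le_ordProj_xi_of_occurrence` p97646 (dictionary p96490, lower-bound direction), setup existence
`nonempty_xiSetup_freyCurve`, setup independence `Brandt.XiSetup.brandtXi_eq_xi` and the tree's PROVED Serre conductor formula),
`prothDepthFamily_of_etaTwo` (law ∧ supply ⟹ `H`),
`EisensteinQuarantine_false_of_etaTwo`, and the registered target `NotEisensteinQuarantine_of : ERH → NotEisensteinQuarantine`
(`NotEisensteinQuarantine := ¬ EisensteinQuarantine`, the refuting-line convention of `TameLocalReceptacle/Lines/SketchIdeator1`).
In-Lean calibration of `twoDepth` at the census anchors 97 and 257 (`decide`), and the sorry-free helper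
`le_twoDepth_of_pow_eq_one` (the exact arithmetic target the supply stub's prover must hit: `2^s ∣ p−1 ∧ 2^{(p−1)/2^s} ≡ 1 ⟹ s ≤ m₂(p)`).

**Disproof.lean honoured.** §1 (no junk kill: the refutation runs on genuine setups — `nonempty_xiSetup_freyCurve` — and
the LOWER-bound stubs carry the rank-one premise explicitly, `stub_freyEigenLineRankOne`, because `ordProj[2] 0 = 1` would make a
lower bound false, not the crux); §2–§3 (`PierpontDepthLaw`, `pierpontDepthLaw_census`): NOT used — this line predicts them
FALSE (`m₂(3·2^s+1) ≤ 2`), as TRIAGE-r1-1 v4 measured; §4 C″ respected (`(q²−1)₂ ≥ 2^{m₂(q)+1}` dominates the η₂ term);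
§5: the dead stub `stub_twoAdicOccurrenceBound` (an UPPER bound, false on `F`) is not re-entered — this line bounds from
BELOW.  Landed Negative lemmas: p107816 is CONSUMED verbatim (`EisensteinQuarantine_false_of_ProthDepthFamily`); no stub is
an instance refuted by `…_of_ProthDepthLaw` / `eisensteinQuarantine_false_of_pierpontDepthLaw` (their hypotheses are the
dead uniform laws; they refute the crux, not lower bounds).  No `_false_without_H` theorem exists in Disproof.lean.
-/

-- `Summit.<Summit>.<Problem>`: for the single-conjunct summit `ABC` the duplicate `ABC.ABC` is mandated.
set_option linter.dupNamespace false

noncomputable section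

namespace Summit.ABC.ABC.Cruxes.EisensteinQuarantine.EtaTwoResiduacityDepth

open scoped BigOperators
open Literature.NumberTheory.Automorphic Literature.NumberTheory.EllipticCurves
open Summit.ABC.ABC.Theorems.XiBound.Negative
open Summit.ABC.ABC.Theorems.EisensteinQuarantine.Negative

/-! ## The objects of the line -/

/-- **The 2-power residuacity depth of 2 modulo `p`**: `m₂(p) := v₂[𝔽_p^× : ⟨2⟩] = v₂((p − 1) / ord_p 2)`;
`2` is a `2^m`-th power residue modulo the odd prime `p` iff `m ≤ m₂(p)`.  (`m₂(257) = 4`, `m₂(65537) = 11`,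
`m₂(3·2^s + 1) ∈ {1, 2}` for all `s ≤ 41`.)  Junk (`p` not an odd prime) is never used. -/
def twoDepth (p : ℕ) : ℕ := padicValNat 2 ((p - 1) / orderOf (2 : ZMod p))

/-- **Reduction target of the supply stub** (sorry-free helper for the stub-3 prover): if `2^s ∣ p − 1` and
`2^{(p−1)/2^s} = 1` in `ZMod p` (i.e. `2` is a `2^s`-th power residue — what a degree-one prime of
`ℚ(ζ_{2^s}, 2^{1/2^s})` above `p` delivers), then `s ≤ m₂(p)`.  Proof: `ord_p 2 ∣ (p−1)/2^s`, so `2^s ∣ (p−1)/ord_p 2 ≠ 0`. -/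
theorem le_twoDepth_of_pow_eq_one {p s : ℕ} (hp : p.Prime) (hs : 2 ^ s ∣ p - 1)
    (h : (2 : ZMod p) ^ ((p - 1) / 2 ^ s) = 1) : s ≤ twoDepth p := by
  haveI := Fact.mk hp
  have hp1 : p - 1 ≠ 0 := by have := hp.two_le; omega
  set r := orderOf (2 : ZMod p) with hr
  have hr_dvd : r ∣ (p - 1) / 2 ^ s := orderOf_dvd_of_pow_eq_one h
  obtain ⟨u, hu⟩ := hr_dvd
  obtain ⟨m, hm⟩ := hs
  have h2s : 0 < 2 ^ s := pow_pos two_pos s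
  have hm' : m = r * u := by
    have : (p - 1) / 2 ^ s = m := by rw [hm, Nat.mul_div_cancel_left _ h2s]
    rw [← this, hu]
  have hr0 : r ≠ 0 := by
    rintro h0
    rw [h0, zero_mul] at hm'
    rw [hm', mul_zero] at hm
    exact hp1 hm
  have hdiv : (p - 1) / r = 2 ^ s * u := by
    rw [hm, hm', show 2 ^ s * (r * u) = r * (2 ^ s * u) by ring,
      Nat.mul_div_cancel_left _ (Nat.pos_of_ne_zero hr0)]
  have hne : (p - 1) / r ≠ 0 := by
    rw [hdiv]
    refine Nat.mul_ne_zero (pow_ne_zero _ two_ne_zero) ?_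
    rintro rfl
    rw [hm', mul_zero] at hm
    simp at hm
    exact hp1 hm
  rw [twoDepth, ← hr]
  exact (padicValNat_dvd_iff_le hne).mp ⟨u, hdiv⟩

/-- **The η₂-depth law** (arithmetic half of the line; census-true 36/36 with `c = 0` and 3 bits to spare): for every
prime `p ≡ 1 (mod 32)` the 2-part of the quarantined congruence number of the Legendre–Proth Frey curve `E_(−p, p−1)`
at `(N⁺, N⁻) = (N/p, p)` is at least `2^{m₂(p) − c}`.  Must stay a PURE residuacity bound (triage r2-1 sharpen (2): the
variant with an extra factor `𝓛` is census-false at `(2, 65537)`). -/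
def EtaTwoDepthLaw : Prop :=
  ∃ c : ℕ, ∀ p : ℕ, p.Prime → 2 ^ 5 ∣ p - 1 →
    ∀ N : ℕ, (freyCurve (-(p : ℤ)) ((p - 1 : ℕ) : ℤ)).conductorNorm ℤ = N →
      2 ^ twoDepth p ≤ 2 ^ c *
        ordProj[2] (brandtXi (N / p) p (fun n => (freyCurve (-(p : ℤ)) ((p - 1 : ℕ) : ℤ)).LFunction n))

/-- **Deep-2 Proth supply** (Chebotarev half of the line): for some `A` there are arbitrarily large `s` and primes
`p ≤ 2^{A s}` with `2^s ∣ p − 1` and `s ≤ m₂(p)` — i.e. `p` splits completely in `K_s = ℚ(ζ_{2^s}, 2^{1/2^s})`.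
TRUE under ERH with `A = 5` (Lagarias–Odlyzko / Bach–Sorenson: least split prime `≤ (4 log d_K + 2.5 n_K + 5)²`,
`log d_{K_s} ≍ s·4^s`); unconditionally OPEN (every unconditional Chebotarev least-prime bound is `2^{O(s·4^s)}`). -/
def DeepTwoProthSupply : Prop :=
  ∃ A : ℕ, ∀ s₀ : ℕ, ∃ s p : ℕ, s₀ ≤ s ∧ p.Prime ∧ 2 ^ s ∣ p - 1 ∧ p ≤ 2 ^ (A * s) ∧ s ≤ twoDepth p

/-! ## In-Lean calibration of `twoDepth` at two census anchors -/

/-- `ord₉₇ 2 = 48` (Pierpont prime `97 = 3·2⁵ + 1`). -/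
theorem orderOf_two_zmod_97 : orderOf (2 : ZMod 97) = 48 := by
  rw [orderOf_eq_iff (by norm_num)]
  refine ⟨by decide, fun m hm hm0 => ?_⟩
  interval_cases m <;> decide

/-- `m₂(97) = 1`: SHALLOW although `s = 5` (census `v₂ ξ(6, 97) = 6 = base 2 + Sk 3 + m₂ 1`). -/
theorem twoDepth_97 : twoDepth 97 = 1 := by
  rw [twoDepth, orderOf_two_zmod_97, show (97 - 1) / 48 = 2 ^ 1 by norm_num, padicValNat.prime_pow]

/-- `ord₂₅₇ 2 = 16` (Fermat prime `257 = 2⁸ + 1`). -/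
theorem orderOf_two_zmod_257 : orderOf (2 : ZMod 257) = 16 := by
  rw [orderOf_eq_iff (by norm_num)]
  refine ⟨by decide, fun m hm hm0 => ?_⟩
  interval_cases m <;> decide

/-- `m₂(257) = 4`: DEEP (Lean-native census `ξ(2, 257) = 2⁷ = 2^{m₂+3}`). -/
theorem twoDepth_257 : twoDepth 257 = 4 := by
  rw [twoDepth, orderOf_two_zmod_257, show (257 - 1) / 16 = 2 ^ 4 by norm_num, padicValNat.prime_pow]

/-! ## Registered stubs -/

/-- **stub 1 — the Frey eigen-line (Jacquet–Langlands/Eichler + strong multiplicity one; TRUE in print, L/XL formal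
debt).**  On the crux's domain (coprime `a, b`, `ab(a+b) ≠ 0`, `N` the conductor of `E_(a,b)`, admissible `N⁻ = Nm`:
odd, squarefree, `ω` odd, `Nm ∣ N`), in EVERY Brandt setup `S` of type `(N/Nm, Nm)` the common eigen-lattice of the
Brandt matrices `T_ℓ` (`ℓ ∤ N`) for the system `ℓ ↦ a_ℓ(E_(a,b))` is a line `ℤ φ`, `φ ≠ 0`.  Why: `f_E` is new of level
`N = N⁺N⁻`, Steinberg at every odd bad prime (`E_(a,b)` is semistable away from 2, `Nm` odd), so by Eichler/JL it occurs
in `ℂ[Cls O] ≅ Eis ⊕ ⨁_{M ∣ N⁺} S₂^{new}(M N⁻)^{⊕ d(N⁺/M)}` exactly once (strong multiplicity one: a system agreeing with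
`a_ℓ(E)` off `N` has newform `f_E`, of exact level `N`; the Eisenstein system `ℓ + 1` differs by Hasse); the `ℚ`-eigenspace
is a line and the eigen-lattice is saturated (`Brandt.mem_eigenLattice_of_smul_mem`).  Needed by EVERY lower bound on
`ξ` (off a line `ξ` is the junk `0`, `ordProj[2] 0 = 1`).  Sources: Eichler 1955/Pizer 1980; Gross 1987 §§3–5;
Pollack–Weston 2011 §2.1; Voight 2021 Thm. 41.3.1; multiplicity one: Atkin–Lehner/Li, Miyake Thm. 4.6.19. -/
theorem stub_freyEigenLineRankOne :
    ∀ a b : ℤ, IsCoprime a b → a * b * (a + b) ≠ 0 →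
      ∀ (N : ℕ) [NeZero N], (freyCurve a b).conductorNorm ℤ = N →
      ∀ Nm : ℕ, Odd Nm → Squarefree Nm → Odd Nm.primeFactors.card → Nm ∣ N →
      ∀ (S : Brandt.XiSetup (N / Nm) Nm) [Fintype (Brandt.ClassSet S.O)],
        ∃ φ : Brandt.ClassSet S.O → ℤ, φ ≠ 0 ∧
          Brandt.eigenLattice (N / Nm * Nm) (Brandt.matrix S.O)
              (fun n => (freyCurve a b).LFunction n) = ℤ ∙ φ := by
  sorry

/-- **stub 2 — the η₂-witness (THE MECHANISM; hardest stub; XL, research-level).**  There is an absolute `c` such that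
for every prime `p ≡ 1 (mod 32)`, with `E = E_(−p, p−1)` (Legendre curve `y² = x(x+p)(x+p−1)`, Serre-normalised, conductor
`N = 2p·rad((p−1)/2^{v₂(p−1)})`), every Brandt setup `S` of type `(N/p, p)` and every generator `φ` of the Frey eigen-line:
some Brandt vector `ψ`, `w`-orthogonal to `φ`, is congruent to `φ` modulo `2^{m₂(p) − c}`.  By the landed dictionary
(`stub_latticeDepth_dvd_iff`, p96490) this is `2^{m₂(p) − c} ∣ ξ/d`, `d = gcd(w_i φ_i) ∣ 12` — the η₂-depth law in
certificate form (`etaTwoDepthLaw_of_witness`).  Mechanism (card §Lever/(2)): `ψ` is built from the U₂-ORDINARY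
stabilisations of the level-`p` 2-Eisenstein cluster, on whose higher Eisenstein elements `η₂ = T₂ − 3` acts by
`log √2`, `v₂(log √2) = m₂(p) − 1` (Lecouturier arXiv:1709.09114 §1 + Thm. 1.5/§3.6 for the supersingular module;
Calegari–Emerton arXiv:math/0311368 Prop. 3.17(ii): `η₂` generates the 2-Eisenstein ideal iff `m₂(p) = 1` for `p ≡ 1 (16)`),
level-raised to `N⁺ = N/p ∋ 2` where the Frey line (`a₂(E) = +1`, a theorem on `F`: triage r2-2 (b)) meets the ordinary old
line to the full depth of `η₂` (slope separation at `ℓ = 2` only).  Census: witness depth `v₂(ξ/d) ≥ v₂ξ − 2 ≥ m₂(p) + 1`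
on 36/36 levels (card table; triage r2-1/r2-2 recomputed), so `c = 0` fits.  Why it might fail: the two `s = 12` rows are
surpluses (harmless); a kill is any future row with `2 ∣ N`, `a₂ = +1` and `v₂ ξ(N/p,p) < m₂(p) + 1` — cheapest sharp test
pre-registered by triage r2-2: `p = 4513` (`m₂ = s = 5`; law ⇒ `v₂ deg_Frey ≥ 9`, point prediction 17–20, kill `≤ 8`).
OUT-OF-SAMPLE RESULT (this seat, kit j020814 + j020843, PARI `ellmoddegree` over isogeny classes, 8 fresh deep-`m₂` Proth primes
2593, 10369, 1249, 2113, 2657, 7489, 6529, 4513 with `m₂ = 5,3,3,4,4,4,6,5`): the stub AT `c = 0` holds in the RIGOROUS class-min form on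
8/8 rows (`classmin − 3 − m₂ = 2,4,8,6,4,9,7,5`; 4513: `v₂ deg_Frey = 14`, class `[14,13,15,15]`), the envelope `d ≥ m₂+3` 8/8; the
additive point model is looser (v2 windows 6/8) — see the line card's last section.
Formal debt below the statement: JL/Eichler for `brandtXi` (shared with stub 1), Mazur/Lecouturier/C–E at `ℓ = 2`,
reducible level raising through the primes of `N⁺` at an Eisenstein maximal ideal (Ribet; Yoo for `ℓ ≥ 5` only). -/
theorem stub_etaTwoWitness :
    ∃ c : ℕ, ∀ p : ℕ, p.Prime → 2 ^ 5 ∣ p - 1 →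
      ∀ N : ℕ, (freyCurve (-(p : ℤ)) ((p - 1 : ℕ) : ℤ)).conductorNorm ℤ = N →
      ∀ (S : Brandt.XiSetup (N / p) p) [Fintype (Brandt.ClassSet S.O)],
        ∀ φ : Brandt.ClassSet S.O → ℤ, φ ≠ 0 →
          Brandt.eigenLattice (N / p * p) (Brandt.matrix S.O)
              (fun n => (freyCurve (-(p : ℤ)) ((p - 1 : ℕ) : ℤ)).LFunction n) = ℤ ∙ φ →
          ∃ ψ : Brandt.ClassSet S.O → ℤ,
            ∑ i, (Brandt.weight S.O i : ℤ) * ψ i * φ i = 0 ∧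
              ∀ i, ((2 ^ (twoDepth p - c) : ℕ) : ℤ) ∣ φ i - ψ i := by
  sorry

/-- **stub 3 — deep-2 Proth supply under ERH (TRUE in print; L).**  The Extended Riemann Hypothesis for all number
fields (`Literature.NumberTheory.LFunctions.ExtendedRiemannHypothesis`, the tree's `@[conjecture]`) implies
`DeepTwoProthSupply` (unfolded): some `A` admits, for every `s₀`, an `s ≥ s₀` and a prime `p ≤ 2^{As}` with
`2^s ∣ p − 1` and `s ≤ m₂(p)`.  Proof plan: `K_s := ℚ(ζ_{2^s}, 2^{1/2^s})` (splitting field of `X^{2^s} − 2`) has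
`n_K ≤ 2^{2s−1}`, only `2` ramifies and `log|d_K| ≤ n_K(1 + log₂ n_K) log 2 ≍ s·4^s` (Serre's local bound
`v_p(𝔡) ≤ n − 1 + n v_p(n)`); the tree's PROVED GRH bounds `NumberField.primeIdealCount_ge_of_erh`
(`π_K(x) ≥ x/(2 log x) − (C+2)(log|d_K| + n_K)√x`) and `PrimeIdealCountDegreeOne` (`π_K(x) ≤ ∑_{p ≤ x} c_K(p) + n_K π(√x)`)
give an odd prime `p ≤ x ≍ (s·4^s)^{2+o(1)} ≤ 2^{5s}` with a degree-one prime of `K_s` above it; reducing `ζ_{2^s}` and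
`2^{1/2^s}` modulo it yields `2^s ∣ p − 1` and `2^{(p−1)/2^s} ≡ 1 (mod p)`, i.e. `ord_p 2 ∣ (p−1)/2^s`, i.e. `s ≤ m₂(p)`.
Sources: Lagarias–Odlyzko 1977 Thm. 1.1/Cor. 1.2; Bach–Sorenson, Math. Comp. 65 (1996) Thm. 5.1; Serre 1981 §2.
Why it might fail: it does not (theorem under the displayed hypothesis); size only. -/
theorem stub_deepTwoSupply_of_erh :
    Literature.NumberTheory.LFunctions.ExtendedRiemannHypothesis →
      ∃ A : ℕ, ∀ s₀ : ℕ, ∃ s p : ℕ, s₀ ≤ s ∧ p.Prime ∧ 2 ^ s ∣ p - 1 ∧ p ≤ 2 ^ (A * s) ∧ s ≤ twoDepth p := by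
  sorry

/-! ## The reduction (sorry-free) -/

/-- **Stubs 1–2 ⟹ the η₂-depth law.**  On `F` a setup of type `(N/p, p)` exists (`nonempty_xiSetup_freyCurve`, with the
tree's PROVED Serre conductor formula `N = rad(p(p−1))`) and computes `brandtXi` (setup independence,
`Brandt.XiSetup.brandtXi_eq_xi`); on the Frey line `ℤ φ` (stub 1) the witness of stub 2 is an occurrence of `φ` modulo
`2^{m₂(p)−c}` in its `w`-orthogonal complement, which forces `2^{m₂(p)−c} ∣ ξ = Σ w_i φ_i² ≠ 0` (landed
`Summit.ABC.ABC.Theorems.pow_le_ordProj_xi_of_occurrence`, p97646 — the dictionary p96490 read in the lower-bound direction);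
hence `2^{m₂(p)} ≤ 2^c · ordProj[2] ξ`. -/
theorem etaTwoDepthLaw_of_witness
    (hline : ∀ a b : ℤ, IsCoprime a b → a * b * (a + b) ≠ 0 →
      ∀ (N : ℕ) [NeZero N], (freyCurve a b).conductorNorm ℤ = N →
      ∀ Nm : ℕ, Odd Nm → Squarefree Nm → Odd Nm.primeFactors.card → Nm ∣ N →
      ∀ (S : Brandt.XiSetup (N / Nm) Nm) [Fintype (Brandt.ClassSet S.O)],
        ∃ φ : Brandt.ClassSet S.O → ℤ, φ ≠ 0 ∧
          Brandt.eigenLattice (N / Nm * Nm) (Brandt.matrix S.O)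
              (fun n => (freyCurve a b).LFunction n) = ℤ ∙ φ)
    (hwit : ∃ c : ℕ, ∀ p : ℕ, p.Prime → 2 ^ 5 ∣ p - 1 →
      ∀ N : ℕ, (freyCurve (-(p : ℤ)) ((p - 1 : ℕ) : ℤ)).conductorNorm ℤ = N →
      ∀ (S : Brandt.XiSetup (N / p) p) [Fintype (Brandt.ClassSet S.O)],
        ∀ φ : Brandt.ClassSet S.O → ℤ, φ ≠ 0 →
          Brandt.eigenLattice (N / p * p) (Brandt.matrix S.O)
              (fun n => (freyCurve (-(p : ℤ)) ((p - 1 : ℕ) : ℤ)).LFunction n) = ℤ ∙ φ →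
          ∃ ψ : Brandt.ClassSet S.O → ℤ,
            ∑ i, (Brandt.weight S.O i : ℤ) * ψ i * φ i = 0 ∧
              ∀ i, ((2 ^ (twoDepth p - c) : ℕ) : ℤ) ∣ φ i - ψ i) :
    EtaTwoDepthLaw := by
  obtain ⟨c, hc⟩ := hwit
  refine ⟨c, fun p hp h32 N hN => ?_⟩
  -- specialise the witness at `p` before renaming the Frey data
  have hc' := hc p hp h32
  clear hc
  -- elementary data of the Legendre–Proth point `(a, b) = (−p, p−1)` (as in p107816)
  have hp1le : 1 ≤ p := hp.one_lt.le
  have hM0 : p - 1 ≠ 0 := by have := hp.two_le; omega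
  have h32' : (32 : ℕ) ∣ p - 1 := by norm_num at h32; exact h32
  have h32le : 32 ≤ p - 1 := Nat.le_of_dvd (Nat.pos_of_ne_zero hM0) h32'
  have hp2 : p ≠ 2 := by omega
  set a : ℤ := -(p : ℤ) with ha
  set b : ℤ := ((p - 1 : ℕ) : ℤ) with hb
  have hpcast : (p : ℤ) = ((p - 1 : ℕ) : ℤ) + 1 := by
    rw [Nat.cast_sub hp1le]; push_cast; ring
  have hab_sum : a + b = -1 := by rw [ha, hb, hpcast]; ring
  have habc : a * b * (a + b) = ((p * (p - 1) : ℕ) : ℤ) := by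
    rw [hab_sum, ha, hb]; push_cast; ring
  have hPM0 : p * (p - 1) ≠ 0 := Nat.mul_ne_zero hp.ne_zero hM0
  have h0 : a * b * (a + b) ≠ 0 := by rw [habc]; exact_mod_cast hPM0
  have hab : IsCoprime a b := by
    rw [ha, hb, IsCoprime.neg_left_iff, Int.isCoprime_iff_gcd_eq_one, Int.gcd_natCast_natCast]
    exact (Nat.coprime_self_sub_right hp1le).mpr (Nat.coprime_one_right p)
  have h4M : (4 : ℕ) ∣ p - 1 := (show (4 : ℕ) ∣ 32 by norm_num).trans h32'
  have ha4 : a ≡ -1 [ZMOD 4] := by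
    have h4 : (4 : ℤ) ∣ b := by rw [hb]; exact_mod_cast h4M
    have : a = -1 - b := by rw [ha, hb, hpcast]; ring
    rw [this]
    calc -1 - b ≡ -1 - 0 [ZMOD 4] := Int.ModEq.sub_left _ ((Int.modEq_zero_iff_dvd).mpr h4)
      _ = -1 := by ring
  have hb32 : (32 : ℤ) ∣ b := by rw [hb]; exact_mod_cast h32'
  have hnatAbs : (a * b * (a + b)).natAbs = p * (p - 1) := by rw [habc, Int.natAbs_natCast]
  haveI : (freyCurve a b).IsElliptic := isElliptic_freyCurve h0
  have hNval : N = UniqueFactorizationMonoid.radical (p * (p - 1)) := by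
    rw [← hN, conductorNorm_freyCurve_serre hab h0 ha4 hb32, hnatAbs]
  have hNpos : 0 < N := by rw [hNval]; exact Nat.radical_pos _
  haveI : NeZero N := ⟨hNpos.ne'⟩
  have hpN : p ∣ N := by
    rw [hNval]
    refine Nat.dvd_of_mem_primeFactors ?_
    rw [Nat.primeFactors_radical, Nat.primeFactors_mul hp.ne_zero hM0, hp.primeFactors]
    simp
  have hPodd : Odd p := hp.odd_of_ne_two hp2
  have hPcard : Odd p.primeFactors.card := by rw [hp.primeFactors]; simp
  -- a Brandt setup of type `(N/p, p)` exists and computes `ξ`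
  have hne : Nonempty (Brandt.XiSetup (N / p) p) := by
    have h := nonempty_xiSetup_freyCurve hab h0 hPodd hp.squarefree hPcard (by rw [hN]; exact hpN)
    rwa [hN] at h
  obtain ⟨S⟩ := hne
  letI : Fintype (Brandt.ClassSet S.O) := Fintype.ofFinite _
  rw [S.brandtXi_eq_xi]
  -- the Frey line (stub 1), the witness (stub 2), and the landed occurrence lemma (p97646):
  -- an occurrence `φ ≡ ψ (mod 2^k)`, `ψ ⊥_w φ`, forces `2^k ∣ ξ = Σ w_i φ_i²`, `ξ ≠ 0`
  obtain ⟨φ, hφ, hLφ⟩ := hline a b hab h0 N hN p hPodd hp.squarefree hPcard hpN S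
  obtain ⟨ψ, hψ, hcong⟩ := hc' N hN S φ hφ hLφ
  have hocc : 2 ^ (twoDepth p - c) ≤ ordProj[2] (S.xi fun n => (freyCurve a b).LFunction n) :=
    Summit.ABC.ABC.Theorems.pow_le_ordProj_xi_of_occurrence Nat.prime_two S _ hφ hLφ
      (twoDepth p - c) hψ hcong
  calc 2 ^ twoDepth p ≤ 2 ^ c * 2 ^ (twoDepth p - c) := by
        rw [← pow_add]
        exact Nat.pow_le_pow_right two_pos (by omega)
    _ ≤ 2 ^ c * ordProj[2] (S.xi fun n => (freyCurve a b).LFunction n) :=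
        Nat.mul_le_mul_left _ hocc

/-- **Law ∧ supply ⟹ `H = ProthDepthFamily`** (the hypothesis of the landed Negative lemma p107816): take the deep-2
Proth primes of the supply (with `s ≥ 5`) and bound `2^s ≤ 2^{m₂(p)} ≤ 2^c · ordProj[2] ξ` by the law. -/
theorem prothDepthFamily_of_etaTwo (hlaw : EtaTwoDepthLaw) (hsup : DeepTwoProthSupply) : ProthDepthFamily := by
  obtain ⟨c, hc⟩ := hlaw
  obtain ⟨A, hA⟩ := hsup
  refine ⟨c, A, fun s₀ => ?_⟩
  obtain ⟨s, p, hs, hp, hsp, hpA, hdepth⟩ := hA (max s₀ 5)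
  have hs5 : 5 ≤ s := le_of_max_le_right hs
  have h32 : 2 ^ 5 ∣ p - 1 := (Nat.pow_dvd_pow 2 hs5).trans hsp
  refine ⟨s, p, le_of_max_le_left hs, hp, hsp, hpA, fun N hN => ?_⟩
  calc 2 ^ s ≤ 2 ^ twoDepth p := Nat.pow_le_pow_right two_pos hdepth
    _ ≤ _ := hc p hp h32 N hN

/-- **The line's conclusion from its two named halves**: `EtaTwoDepthLaw ∧ DeepTwoProthSupply ⟹ ¬ EisensteinQuarantine`,
through the landed `EisensteinQuarantine_false_of_ProthDepthFamily` (p107816). -/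
theorem EisensteinQuarantine_false_of_etaTwo (hlaw : EtaTwoDepthLaw) (hsup : DeepTwoProthSupply) :
    ¬ Summit.ABC.ABC.Theses.DefiniteXi.EisensteinQuarantine :=
  EisensteinQuarantine_false_of_ProthDepthFamily (prothDepthFamily_of_etaTwo hlaw hsup)

/-- **`¬ EisensteinQuarantine` under ERH, from the three stubs** (stated with `¬`, for the Negative-lemma prover: once the
stubs land this is `EisensteinQuarantine_false_of_ERH`, to be filed `--negative-modulo ExtendedRiemannHypothesis`). -/
theorem EisensteinQuarantine_false_of_erh
    (hERH : Literature.NumberTheory.LFunctions.ExtendedRiemannHypothesis) :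
    ¬ Summit.ABC.ABC.Theses.DefiniteXi.EisensteinQuarantine :=
  EisensteinQuarantine_false_of_etaTwo (etaTwoDepthLaw_of_witness stub_freyEigenLineRankOne stub_etaTwoWitness)
    (stub_deepTwoSupply_of_erh hERH)

/-! ## Registered target of the refuting line -/

/-- The line's typed target: the NEGATION of the crux decl (refuting-line convention, cf.
`Theorems/TameLocalReceptacle` line `SketchIdeator1`: `NotTameLocalReceptacle`). -/
def NotEisensteinQuarantine : Prop := ¬ Summit.ABC.ABC.Theses.DefiniteXi.EisensteinQuarantine

/-- **Skeleton theorem (registered with `--crux-decl …NotEisensteinQuarantine`)**: the negated crux BY NAME from the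
three registered stubs, under the tree's open conjecture `ExtendedRiemannHypothesis` (an admissible obligation node). -/
theorem NotEisensteinQuarantine_of
    (hERH : Literature.NumberTheory.LFunctions.ExtendedRiemannHypothesis) : NotEisensteinQuarantine :=
  EisensteinQuarantine_false_of_erh hERH

end Summit.ABC.ABC.Cruxes.EisensteinQuarantine.EtaTwoResiduacityDepth

end
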